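/-
Copyright (c) 2026. All rights reserved.
Released under Apache 2.0 license as described in the file LICENSE.
Authors: abc-iut cell, campaign-S prover seat abc-iut-S1 (wave 1).
-/
import Mathlib.Analysis.Normed.Module.FiniteDimension
import Mathlib.Topology.Algebra.Valued.LocallyCompact
import Mathlib.Algebra.CharP.Lemmas
import Mathlib.Data.Nat.Factorization.Basic
import Literature.NumberTheory.Transcendental.PadicLogAlgClProofs
import HarnessLib

/-!
# The `p`-adic logarithm on the units `𝒪_K^×` of a mixed-characteristic nonarchimedean local field

This is the analytic input "log_p(R_i^×)" of [IUTchIV] §1 (Mochizuki, *Inter-universal Teichmüller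
theory IV*, RIMS manuscript Apr. 2020, kurims pp. 9–12: Propositions 1.1–1.4 are phrased in terms of
the `ℤ_p`-submodule `log_p(R^×) ⊆ k` of a finite extension `k ⊆ ℚ̄_p` of `ℚ_p` with ring of integers
`R = 𝒪_k`, "where we write `log_p(−)` for the `p`-adic logarithm", Prop. 1.2 p. 10) and of
[AbsTopIII] Def. 3.1 (iv) (the pre-log-shell `log_k(𝒪_k^×)`; the log-shell of [AbsTopIII] Def. 5.4 (iii)
/ [IUTchIII] Def. 1.1 (i) p. 24 is `(p*)⁻¹·log_k(𝒪_k^×)`, `p* = p` for odd `p`, `p* = p²` for `p = 2`);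
TRANCHE-T1 row P02 of the cell.

## Setting (the norm-side description of an MLF, as in the tree's `UniformizerModulus.lean`)

`K` is a nontrivially normed field which is a normed `ℚ_p`-algebra (`[NormedAlgebra ℚ_[p] K]`, so
`‖p‖ = p⁻¹`, `‖n‖ = |n|_p`, characteristic `0`), ultrametric, and — where units are reduced to
principal units — a proper metric space (= locally compact = finite over `ℚ_p`).  Every finite
extension `k_i ⊆ ℚ̄_p` of `ℚ_p` with the `p`-adic norm (the literal setting of [IUTchIV] Prop. 1.1) is
such a `K` (Mathlib: `PadicAlgCl p` carries the spectral norm; an intermediate field finite over `ℚ_[p]`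
is complete and proper, `FiniteDimensional.complete/proper`, and ultrametric,
`IsUltrametricDist.of_normedAlgebra`), and conversely every such `K` embeds isometrically into `ℚ̄_p`.

## Contents (all PROVED; no named facts)

* `logSeries y = L(y) = -∑_{n≥1} (1-y)ⁿ/n` — the logarithmic series; on principal units `‖1 - y‖ < 1`
  of a complete `K` it converges (`hasSum_logSeries`) and satisfies `L(y₁y₂) = L(y₁) + L(y₂)`,
  `L(yᵏ) = k·L(y)` (the tree's `IwasawaLog.logSeries_mul/pow`, Iwasawa 1972 §4.4, imported);
  the ultrametric bound `‖L(y)‖ ≤ C` whenever every term has norm `≤ C` (`norm_logSeries_le`).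
* `exists_pow_isPrincipal` — every unit `‖u‖ = 1` of a proper `K` has a principal-unit power `uᵏ`,
  `k ≥ 1` (the powers of `u` accumulate in the compact unit ball; this replaces "the residue field is
  finite"), and `exists_pow_isPrincipal_not_dvd` — one may take `k` prime to `p` (if `(v)^p` is a
  principal unit so is `v`: `(1-v)^p ≡ 1 - v^p (mod p𝒪)`).
* `unitLog u := k⁻¹ · L(uᵏ)` for a (any: `unitLog_eq_inv_mul_logSeries`) such `k` when `‖u‖ = 1`, junk
  value `0` when `‖u‖ ≠ 1` (`unitLog_of_norm_ne_one`) — the `p`-adic logarithm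
  `log_p : 𝒪_K^× → K` (Neukirch, *Algebraic Number Theory*, Ch. II (5.4)–(5.5): the unique
  homomorphic extension of the series from `U^{(1)}` to `𝒪_K^× = μ_{q-1} × U^{(1)}`): it IS the series on
  principal units (`unitLog_of_isPrincipal`, `hasSum_unitLog`), a homomorphism on units
  (`unitLog_mul`, `unitLog_inv`, `unitLog_pow`), and kills the roots of unity
  (`unitLog_eq_zero_of_pow_eq_one`).
* `logUnits K = log_p(𝒪_K^×) ⊆ K`, the image of the unit sphere (`= R^×`) under `unitLog`, as a set and
  as an additive subgroup (`logUnitsAddSubgroup`).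

The RADIUS statement [IUTchIV] Prop. 1.2 (i) `p^{a}·R ⊆ log_p(R^×) ⊆ p^{-b}·R` is the sibling file
`LogRadius.lean` (it needs the absolute ramification index, `RamificationInvariants.lean`).
Deliberately NOT here: the Iwasawa extension to all of `K^×` (`log p = 0`; for `ℚ̄_p` it is the tree's
`Literature.NumberTheory.Transcendental.padicLogAlgCl`), the exponential, tensor products of the
`log_p(R_i^×)` (Prop. 1.2 (ii)–(iv)).  Nothing in this file is disputed mathematics; the [IUTchIV]
locators are given because the cell types that text.

## References

* S. Mochizuki, *Inter-universal Teichmüller theory IV*, RIMS manuscript (2020) = PRIMS 57 (2021),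
  §1 Prop. 1.2, kurims p. 10 [Mochizuki2012, claim key of the series, status disputed (D-0012)].
* J. Neukirch, *Algebraic Number Theory*, Grundlehren 322 (1999), Ch. II §5, (5.4)–(5.5)
  [NeukirchANT1999].
* K. Iwasawa, *Lectures on `p`-adic `L`-functions* (1972), §4.4 [Iwasawa1972PadicL].
-/

noncomputable section

open Filter Metric
open _root_.Topology
open IsUltrametricDist

namespace Literature.IUT.LogVolume

open Literature.NumberTheory.Transcendental

variable {p : ℕ} [Fact p.Prime]
variable {K : Type*} [NontriviallyNormedField K]

/-! ## The logarithmic series -/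

/-- The logarithmic series `L(y) = -∑_{n ≥ 1} (1 - y)ⁿ / n` in `K`, written as a `tsum` over `n : ℕ` of
`-(1 - y)^(n+1)/(n+1)`; it converges exactly on the principal units `‖1 - y‖ < 1` (of a complete `K`),
elsewhere `tsum` returns the junk value `0`. This is "the `p`-adic logarithm" of [IUTchIV] Prop. 1.2
(p. 10) on principal units. [cite: NeukirchANT1999, Ch. II (5.4)] -/
def logSeries (y : K) : K := ∑' n : ℕ, -((1 - y) ^ (n + 1)) / (n + 1 : K)

/-- `L(1) = 0`. [cite: NeukirchANT1999, Ch. II (5.4)] -/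
@[simp] theorem logSeries_one : logSeries (1 : K) = 0 := by
  simp [logSeries]

section Series

variable [instK : NormedAlgebra ℚ_[p] K]
include instK

variable (p) in
/-- **Convergence on principal units**: for `‖1 - y‖ < 1` in a complete `K`,
`HasSum (n ↦ -(1-y)^(n+1)/(n+1)) (L(y))`. [cite: NeukirchANT1999, Ch. II (5.4)] -/
theorem hasSum_logSeries [CompleteSpace K] {y : K} (hy : ‖1 - y‖ < 1) :
    HasSum (fun n : ℕ ↦ -((1 - y) ^ (n + 1)) / (n + 1 : K)) (logSeries y) :=
  (IwasawaLog.summable_logTerm (p := p) hy).hasSum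

variable (p) in
/-- **Functional equation** `L(y₁ y₂) = L(y₁) + L(y₂)` on principal units of a complete ultrametric `K`
(the tree's `IwasawaLog.logSeries_mul`, Iwasawa 1972 §4.4). [cite: NeukirchANT1999, Ch. II (5.4)] -/
theorem logSeries_mul [CompleteSpace K] [IsUltrametricDist K] {y₁ y₂ : K} (h₁ : ‖1 - y₁‖ < 1)
    (h₂ : ‖1 - y₂‖ < 1) : logSeries (y₁ * y₂) = logSeries y₁ + logSeries y₂ :=
  IwasawaLog.logSeries_mul (p := p) h₁ h₂

variable (p) in
/-- `L(yᵏ) = k · L(y)` on principal units. [cite: NeukirchANT1999, Ch. II (5.4)] -/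
theorem logSeries_pow [CompleteSpace K] [IsUltrametricDist K] {y : K} (h : ‖1 - y‖ < 1) (k : ℕ) :
    logSeries (y ^ k) = k * logSeries y :=
  IwasawaLog.logSeries_pow (p := p) h k

end Series

/-- **Ultrametric bound for the logarithmic series**: if every term `-(1-y)^(n+1)/(n+1)` has norm `≤ C`
(`C ≥ 0`) then `‖L(y)‖ ≤ C` (ultrametric inequality for `tsum`; no convergence hypothesis is needed).
[cite: NeukirchANT1999, Ch. II (5.4)] -/
theorem norm_logSeries_le [IsUltrametricDist K] {y : K} {C : ℝ} (hC : 0 ≤ C)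
    (h : ∀ n : ℕ, ‖-((1 - y) ^ (n + 1)) / (n + 1 : K)‖ ≤ C) : ‖logSeries y‖ ≤ C :=
  IsUltrametricDist.norm_tsum_le_of_forall_le_of_nonneg hC h

/-! ## Principal units and reduction of units to principal units -/

/-- `y` is a **principal unit** (`y ∈ U^{(1)} = 1 + 𝔪_K`): `‖1 - y‖ < 1`.
[cite: NeukirchANT1999, Ch. II (5.3)] -/
def IsPrincipal (y : K) : Prop := ‖1 - y‖ < 1

/-- Unfolding `IsPrincipal`. [cite: NeukirchANT1999, Ch. II (5.3)] -/
theorem isPrincipal_iff (y : K) : IsPrincipal y ↔ ‖1 - y‖ < 1 := Iff.rfl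

section Ultra

variable [IsUltrametricDist K]

/-- A principal unit has norm `1`. [cite: NeukirchANT1999, Ch. II (5.3)] -/
theorem IsPrincipal.norm_eq_one {y : K} (hy : IsPrincipal y) : ‖y‖ = 1 :=
  IwasawaLog.norm_eq_one_of_norm_one_sub_lt hy

/-- Principal units are closed under products. [cite: NeukirchANT1999, Ch. II (5.3)] -/
theorem IsPrincipal.mul {y₁ y₂ : K} (h₁ : IsPrincipal y₁) (h₂ : IsPrincipal y₂) :
    IsPrincipal (y₁ * y₂) :=
  IwasawaLog.norm_one_sub_mul_lt h₁ h₂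

/-- Principal units are closed under powers. [cite: NeukirchANT1999, Ch. II (5.3)] -/
theorem IsPrincipal.pow {y : K} (h : IsPrincipal y) (k : ℕ) : IsPrincipal (y ^ k) :=
  IwasawaLog.norm_one_sub_pow_lt h k

/-- Principal units are closed under inverses. [cite: NeukirchANT1999, Ch. II (5.3)] -/
theorem IsPrincipal.inv {y : K} (h : IsPrincipal y) : IsPrincipal y⁻¹ :=
  IwasawaLog.norm_one_sub_inv_lt h

/-- If some positive power of `x` is a principal unit then `‖x‖ = 1`.
[cite: NeukirchANT1999, Ch. II (5.3)] -/
theorem norm_eq_one_of_isPrincipal_pow {x : K} {k : ℕ} (hk : 0 < k) (h : IsPrincipal (x ^ k)) :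
    ‖x‖ = 1 := by
  have h1 : ‖x‖ ^ k = 1 := by rw [← norm_pow]; exact h.norm_eq_one
  exact (pow_eq_one_iff_of_nonneg (norm_nonneg x) hk.ne').mp h1

/-- **Every unit of a locally compact `K` has a principal-unit power**: if `‖u‖ = 1` then
`‖1 - uᵏ‖ < 1` for some `k ≥ 1` (the powers of `u` lie in the compact unit ball and accumulate;
`‖uⁱ - uʲ‖ < 1` gives `‖1 - u^{j-i}‖ < 1`; classically: `u^{q-1} ∈ U^{(1)}` with `q = #(𝒪/𝔪)`).
Port of the tree's `IwasawaLog.exists_norm_one_sub_pow_lt` (stated there inside `ℚ̄_p`).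
[cite: NeukirchANT1999, Ch. II (5.3)] -/
theorem exists_pow_isPrincipal [ProperSpace K] {u : K} (hu : ‖u‖ = 1) :
    ∃ k : ℕ, 0 < k ∧ IsPrincipal (u ^ k) := by
  have hUn : ∀ n : ℕ, ‖u ^ n‖ = 1 := fun n ↦ by rw [norm_pow, hu, one_pow]
  have hmem : ∀ n : ℕ, u ^ n ∈ closedBall (0 : K) 1 := fun n ↦ by
    rw [mem_closedBall, dist_zero_right, hUn]
  obtain ⟨a, -, φ, hφ, hlim⟩ := (isCompact_closedBall (0 : K) 1).tendsto_subseq hmem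
  obtain ⟨N, hN⟩ := Metric.tendsto_atTop.mp hlim 1 one_pos
  have h1 : ‖u ^ φ N - a‖ < 1 := by rw [← dist_eq_norm]; exact hN N le_rfl
  have h2 : ‖u ^ φ (N + 1) - a‖ < 1 := by rw [← dist_eq_norm]; exact hN (N + 1) N.le_succ
  have hlt : φ N < φ (N + 1) := hφ N.lt_succ_self
  refine ⟨φ (N + 1) - φ N, Nat.sub_pos_of_lt hlt, ?_⟩
  have h3 : ‖u ^ φ N - u ^ φ (N + 1)‖ < 1 := by
    have : u ^ φ N - u ^ φ (N + 1) = (u ^ φ N - a) + (-(u ^ φ (N + 1) - a)) := by ring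
    rw [this]
    refine (norm_add_le_max _ _).trans_lt (max_lt h1 ?_)
    rwa [norm_neg]
  have h4 : u ^ φ N - u ^ φ (N + 1) = u ^ φ N * (1 - u ^ (φ (N + 1) - φ N)) := by
    rw [mul_sub, mul_one, ← pow_add, Nat.add_sub_cancel' hlt.le]
  rw [h4, norm_mul, hUn, one_mul] at h3
  exact h3

section PrimeToP

open scoped NormedField

variable [instK : NormedAlgebra ℚ_[p] K]
include instK

/-- **`p`-th roots of principal units among units are principal**: if `‖v‖ ≤ 1` and `v^p` is a
principal unit, so is `v` (in `𝒪 = {‖x‖ ≤ 1}`: `(1 - v)^p = 1 + (-v)^p + p·(-v)·r` with `‖r‖ ≤ 1`, and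
`‖p‖ < 1`; i.e. the Frobenius of the residue field is injective). [cite: NeukirchANT1999, Ch. II (5.3)] -/
theorem IsPrincipal.of_pow_prime {v : K} (hv : ‖v‖ ≤ 1) (h : IsPrincipal (v ^ p)) : IsPrincipal v := by
  have hp : p.Prime := Fact.out
  have hpn : ‖(p : K)‖ < 1 := IwasawaLog.norm_prime_lt_one (p := p) (F := K)
  -- work in the valuation ring `𝒪 = {‖x‖ ≤ 1}` to control the norm of the remainder `r`
  set V : Valued.integer K := ⟨v, Valued.integer.mem_iff.mpr hv⟩ with hV
  obtain ⟨r, hr⟩ := exists_add_pow_prime_eq hp (1 : Valued.integer K) (-V)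
  have hr' : ((1 : K) + -v) ^ p = 1 + (-v) ^ p + (p : K) * 1 * (-v) * (r : K) := by
    have := congrArg (fun z : Valued.integer K ↦ (z : K)) hr
    simpa [hV] using this
  have hrn : ‖(r : K)‖ ≤ 1 := Valued.integer.norm_le_one r
  -- the error term `p · (-v) · r` has norm `< 1`
  have herr : ‖(p : K) * 1 * (-v) * (r : K)‖ < 1 := by
    rw [norm_mul, norm_mul, norm_mul, norm_one, mul_one, norm_neg]
    calc ‖(p : K)‖ * ‖v‖ * ‖(r : K)‖ ≤ ‖(p : K)‖ * 1 * 1 := by gcongr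
      _ = ‖(p : K)‖ := by ring
      _ < 1 := hpn
  -- `1 + (-v)^p` has norm `< 1`: for odd `p` it is `1 - v^p`; for `p = 2` it is `(1 - v²) + 2v²`
  have hmain : ‖(1 : K) + (-v) ^ p‖ < 1 := by
    rcases hp.eq_two_or_odd' with h2 | hodd
    · subst h2
      have : (1 : K) + (-v) ^ 2 = (1 - v ^ 2) + (2 : ℕ) * v ^ 2 := by push_cast; ring
      rw [this]
      refine (norm_add_le_max _ _).trans_lt (max_lt h ?_)
      rw [norm_mul, norm_pow]
      calc ‖((2 : ℕ) : K)‖ * ‖v‖ ^ 2 ≤ ‖((2 : ℕ) : K)‖ * 1 ^ 2 := by gcongr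
        _ < 1 := by rw [one_pow, mul_one]; exact hpn
    · rw [hodd.neg_pow, ← sub_eq_add_neg]
      exact h
  have hpow : ‖(1 : K) - v‖ ^ p < 1 := by
    rw [← norm_pow, sub_eq_add_neg, hr']
    exact (norm_add_le_max _ _).trans_lt (max_lt hmain herr)
  by_contra hge
  rw [IsPrincipal, not_lt] at hge
  exact absurd hpow (not_lt.mpr (one_le_pow₀ hge))

/-- Peeling off powers of `p`: if `v^(p^s · m)` is a principal unit and `‖v‖ ≤ 1` then `v^m` is a
principal unit. [cite: NeukirchANT1999, Ch. II (5.3)] -/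
theorem IsPrincipal.of_pow_prime_pow_mul {v : K} (hv : ‖v‖ ≤ 1) (s m : ℕ)
    (h : IsPrincipal (v ^ (p ^ s * m))) : IsPrincipal (v ^ m) := by
  induction s with
  | zero => simpa using h
  | succ s ih =>
    apply ih
    have hvm : ‖v ^ (p ^ s * m)‖ ≤ 1 := by rw [norm_pow]; exact pow_le_one₀ (norm_nonneg v) hv
    refine IsPrincipal.of_pow_prime (p := p) hvm ?_
    rw [← pow_mul]
    convert h using 2
    ring

/-- **Every unit has a principal-unit power with exponent prime to `p`** (e.g. `q - 1`): combine
`exists_pow_isPrincipal` with `IsPrincipal.of_pow_prime_pow_mul`. [cite: NeukirchANT1999, Ch. II (5.3)] -/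
theorem exists_pow_isPrincipal_not_dvd [ProperSpace K] {u : K} (hu : ‖u‖ = 1) :
    ∃ m : ℕ, 0 < m ∧ ¬ p ∣ m ∧ IsPrincipal (u ^ m) := by
  obtain ⟨k, hk, hkP⟩ := exists_pow_isPrincipal hu
  obtain ⟨s, m, hm, rfl⟩ := Nat.exists_eq_pow_mul_and_not_dvd hk.ne' p (Fact.out : p.Prime).ne_one
  refine ⟨m, Nat.pos_of_ne_zero (fun h0 ↦ by simp [h0] at hk), hm, ?_⟩
  exact IsPrincipal.of_pow_prime_pow_mul (p := p) hu.le s m hkP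

end PrimeToP

end Ultra

/-! ## The logarithm on units -/

open scoped Classical in
/-- **The `p`-adic logarithm `log_p : 𝒪_K^× → K`** as a function on `K`: for `‖u‖ = 1` pick `k ≥ 1` with
`uᵏ` a principal unit and set `log_p u := k⁻¹ · L(uᵏ)` (independent of `k`,
`unitLog_eq_inv_mul_logSeries`); junk value `0` if no such `k` exists (i.e. `‖u‖ ≠ 1`,
`unitLog_of_norm_ne_one`).  This is the `log_p` of [IUTchIV] Prop. 1.2 (p. 10) restricted to `R^×` and
the `log_k : 𝒪_k^× → k` of [AbsTopIII] Def. 3.1. [cite: NeukirchANT1999, Ch. II (5.4)–(5.5)] -/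
def unitLog (x : K) : K :=
  if h : ∃ k : ℕ, 0 < k ∧ IsPrincipal (x ^ k) then ((h.choose : ℕ) : K)⁻¹ * logSeries (x ^ h.choose)
  else 0

/-- Junk value: `log_p x = 0` unless `‖x‖ = 1`. [cite: NeukirchANT1999, Ch. II (5.5)] -/
theorem unitLog_of_norm_ne_one [IsUltrametricDist K] {x : K} (hx : ‖x‖ ≠ 1) : unitLog x = 0 := by
  unfold unitLog
  rw [dif_neg]
  rintro ⟨k, hk, hkP⟩
  exact hx (norm_eq_one_of_isPrincipal_pow hk hkP)

/-- `log_p 0 = 0` (junk value). [cite: NeukirchANT1999, Ch. II (5.5)] -/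
@[simp] theorem unitLog_zero [IsUltrametricDist K] : unitLog (0 : K) = 0 :=
  unitLog_of_norm_ne_one (by simp)

section Log

variable [instK : NormedAlgebra ℚ_[p] K] [IsUltrametricDist K] [CompleteSpace K]
include instK

variable (p) in
/-- **Independence of the exponent**: `log_p u = k⁻¹ · L(uᵏ)` for EVERY `k ≥ 1` such that `uᵏ` is a
principal unit (`L(u^{kk'}) = k'·L(uᵏ) = k·L(u^{k'})`, characteristic `0`).
[cite: NeukirchANT1999, Ch. II (5.5)] -/
theorem unitLog_eq_inv_mul_logSeries {u : K} {k : ℕ} (hk : 0 < k) (hkP : IsPrincipal (u ^ k)) :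
    unitLog u = ((k : ℕ) : K)⁻¹ * logSeries (u ^ k) := by
  haveI := IwasawaLog.charZero p (F := K)
  have h : ∃ k : ℕ, 0 < k ∧ IsPrincipal (u ^ k) := ⟨k, hk, hkP⟩
  unfold unitLog
  rw [dif_pos h]
  set k₀ := h.choose with hk₀def
  have hk₀ : 0 < k₀ := h.choose_spec.1
  have hk₀P : IsPrincipal (u ^ k₀) := h.choose_spec.2
  have e1 : logSeries (u ^ (k₀ * k)) = k * logSeries (u ^ k₀) := by
    rw [pow_mul, logSeries_pow p hk₀P k]
  have e2 : logSeries (u ^ (k₀ * k)) = k₀ * logSeries (u ^ k) := by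
    rw [mul_comm k₀ k, pow_mul, logSeries_pow p hkP k₀]
  have hk0 : (k : K) ≠ 0 := by exact_mod_cast hk.ne'
  have hk₀0 : (k₀ : K) ≠ 0 := by exact_mod_cast hk₀.ne'
  rw [eq_inv_mul_iff_mul_eq₀ hk0, ← mul_assoc, mul_comm (k : K), mul_assoc, ← e1, e2,
    ← mul_assoc, inv_mul_cancel₀ hk₀0, one_mul]

variable (p) in
/-- **On principal units `log_p` is the logarithmic series**: `‖1 - y‖ < 1 → log_p y = L(y)`.
[cite: NeukirchANT1999, Ch. II (5.4)] -/
theorem unitLog_of_isPrincipal {y : K} (hy : IsPrincipal y) : unitLog y = logSeries y := by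
  rw [unitLog_eq_inv_mul_logSeries p one_pos (by rwa [pow_one]), pow_one, Nat.cast_one, inv_one,
    one_mul]

variable (p) in
/-- … hence `HasSum (n ↦ -(1-y)^(n+1)/(n+1)) (log_p y)` for `‖1 - y‖ < 1`.
[cite: NeukirchANT1999, Ch. II (5.4)] -/
theorem hasSum_unitLog {y : K} (hy : IsPrincipal y) :
    HasSum (fun n : ℕ ↦ -((1 - y) ^ (n + 1)) / (n + 1 : K)) (unitLog y) := by
  rw [unitLog_of_isPrincipal p hy]
  exact hasSum_logSeries p hy

variable (p) in
/-- `log_p 1 = 0`. [cite: NeukirchANT1999, Ch. II (5.5)] -/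
theorem unitLog_one : unitLog (1 : K) = 0 := by
  rw [unitLog_of_isPrincipal p (by simp [IsPrincipal]), logSeries_one]

variable (p) in
/-- **`log_p` is a homomorphism on `𝒪_K^×`**: `log_p (x y) = log_p x + log_p y` for `‖x‖ = ‖y‖ = 1`
(with `xᵃ, yᵇ` principal, `k = ab` works for `x`, `y` and `xy`; then the functional equation of `L`).
[cite: NeukirchANT1999, Ch. II (5.5)] -/
theorem unitLog_mul [ProperSpace K] {x y : K} (hx : ‖x‖ = 1) (hy : ‖y‖ = 1) :
    unitLog (x * y) = unitLog x + unitLog y := by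
  haveI := IwasawaLog.charZero p (F := K)
  obtain ⟨a, ha, haP⟩ := exists_pow_isPrincipal hx
  obtain ⟨b, hb, hbP⟩ := exists_pow_isPrincipal hy
  have hxk : IsPrincipal (x ^ (a * b)) := by rw [pow_mul]; exact haP.pow b
  have hyk : IsPrincipal (y ^ (a * b)) := by rw [mul_comm, pow_mul]; exact hbP.pow a
  have hxyk : IsPrincipal ((x * y) ^ (a * b)) := by rw [mul_pow]; exact hxk.mul hyk
  have hab : 0 < a * b := Nat.mul_pos ha hb
  rw [unitLog_eq_inv_mul_logSeries p hab hxyk, unitLog_eq_inv_mul_logSeries p hab hxk,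
    unitLog_eq_inv_mul_logSeries p hab hyk, mul_pow, logSeries_mul p hxk hyk, mul_add]

variable (p) in
/-- `log_p (uⁿ) = n · log_p u` for `‖u‖ = 1`. [cite: NeukirchANT1999, Ch. II (5.5)] -/
theorem unitLog_pow [ProperSpace K] {u : K} (hu : ‖u‖ = 1) (n : ℕ) :
    unitLog (u ^ n) = n * unitLog u := by
  induction n with
  | zero => simp [unitLog_one p]
  | succ n ih =>
    rw [pow_succ, unitLog_mul p (by rw [norm_pow, hu, one_pow]) hu, ih]
    push_cast
    ring

variable (p) in
/-- `log_p (u⁻¹) = -log_p u` for `‖u‖ = 1`. [cite: NeukirchANT1999, Ch. II (5.5)] -/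
theorem unitLog_inv [ProperSpace K] {u : K} (hu : ‖u‖ = 1) : unitLog u⁻¹ = -unitLog u := by
  have hu0 : u ≠ 0 := norm_pos_iff.mp (by rw [hu]; exact one_pos)
  have hui : ‖u⁻¹‖ = 1 := by rw [norm_inv, hu, inv_one]
  have h := unitLog_mul p hu hui
  rw [mul_inv_cancel₀ hu0, unitLog_one p] at h
  linear_combination -h

variable (p) in
/-- **`log_p` kills the roots of unity**: `ζⁿ = 1`, `n ≥ 1` ⇒ `log_p ζ = 0` (`n · log_p ζ = log_p 1 = 0`
in characteristic `0`); so `log_p(R^×) = log_p(R^× / R^μ)` as used in [IUTchIV] Prop. 1.4 (p. 13).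
[cite: NeukirchANT1999, Ch. II (5.5)] -/
theorem unitLog_eq_zero_of_pow_eq_one [ProperSpace K] {ζ : K} {n : ℕ} (hn : 0 < n) (h : ζ ^ n = 1) :
    unitLog ζ = 0 := by
  haveI := IwasawaLog.charZero p (F := K)
  have hζ : ‖ζ‖ = 1 := by
    have h1 : ‖ζ‖ ^ n = 1 := by rw [← norm_pow, h, norm_one]
    exact (pow_eq_one_iff_of_nonneg (norm_nonneg ζ) hn.ne').mp h1
  have h2 := unitLog_pow p hζ n
  rw [h, unitLog_one p] at h2
  have hn0 : (n : K) ≠ 0 := by exact_mod_cast hn.ne'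
  exact (mul_eq_zero.mp h2.symm).resolve_left hn0

end Log

/-! ## `log_p(𝒪_K^×)` -/

variable (K) in
/-- **`log_p(R^×)`** ([IUTchIV] Prop. 1.2, p. 10; = the UNSCALED pre-log-shell of [AbsTopIII]
Def. 3.1 (iv); the log-shell of [IUTchIII] Def. 1.1 (i) p. 24 is `(p*)⁻¹ · log_p(R^×)` with `p* = p` for
odd `p`, `p* = p²` for `p = 2` — consumers scale): the image of the units `R^× = {‖u‖ = 1}` under `log_p`,
as a subset of `K`. [claim: Mochizuki2012, status: disputed] -/
def logUnits : Set K := unitLog '' {u : K | ‖u‖ = 1}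

/-- Membership in `log_p(R^×)` unfolded. [claim: Mochizuki2012, status: disputed] -/
theorem mem_logUnits_iff {z : K} : z ∈ logUnits K ↔ ∃ u : K, ‖u‖ = 1 ∧ unitLog u = z := by
  simp [logUnits]

/-- `log_p u ∈ log_p(R^×)` for a unit `u`. [claim: Mochizuki2012, status: disputed] -/
theorem unitLog_mem_logUnits {u : K} (hu : ‖u‖ = 1) : unitLog u ∈ logUnits K := ⟨u, hu, rfl⟩

/-- `0 = log_p 1 ∈ log_p(R^×)`. [claim: Mochizuki2012, status: disputed] -/
theorem zero_mem_logUnits [NormedAlgebra ℚ_[p] K] [IsUltrametricDist K] [CompleteSpace K] :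
    (0 : K) ∈ logUnits K :=
  ⟨1, norm_one, unitLog_one p⟩

variable (p K) in
/-- `log_p(R^×)` as an additive subgroup of `K` (image of the group `R^×` under the homomorphism
`log_p`); it is moreover a `ℤ_p`-submodule ("the submodule `log_p(R_I^×)`", [IUTchIV] Prop. 1.2 p. 10),
which is not recorded here. [claim: Mochizuki2012, status: disputed] -/
def logUnitsAddSubgroup [NormedAlgebra ℚ_[p] K] [IsUltrametricDist K] [ProperSpace K] :
    AddSubgroup K where
  carrier := logUnits K
  zero_mem' := zero_mem_logUnits (p := p)
  add_mem' := by
    rintro _ _ ⟨x, hx, rfl⟩ ⟨y, hy, rfl⟩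
    rw [Set.mem_setOf_eq] at hx hy
    exact ⟨x * y, by rw [Set.mem_setOf_eq, norm_mul, hx, hy, one_mul], unitLog_mul p hx hy⟩
  neg_mem' := by
    rintro _ ⟨x, hx, rfl⟩
    rw [Set.mem_setOf_eq] at hx
    exact ⟨x⁻¹, by rw [Set.mem_setOf_eq, norm_inv, hx, inv_one], unitLog_inv p hx⟩

/-- The carrier of `logUnitsAddSubgroup p K` is `logUnits K`. [claim: Mochizuki2012, status: disputed] -/
@[simp] theorem coe_logUnitsAddSubgroup [NormedAlgebra ℚ_[p] K] [IsUltrametricDist K] [ProperSpace K] :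
    ((logUnitsAddSubgroup p K : AddSubgroup K) : Set K) = logUnits K := rfl

end Literature.IUT.LogVolume

end
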